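import Summits.QuantumFields.BalabanUV.Beta.GAN24.WardResidualSUnits
import Summits.QuantumFields.BalabanUV.Beta.GAN24.TowerBoundKFold
import Summits.QuantumFields.BalabanUV.Beta.GAN24.StencilSlotOfShapes
import Summits.QuantumFields.BalabanUV.Beta.GAN24.LocStencilTelescope

/-!
# `BalabanUV.Beta.GAN24.WardRemainderRows` — binder row G-an2-4 ∕ (CONV-C), W-slot CT-W, route «WC-TL» ∕ (Q-R) «QR-LL» (RULING R-gan24p1-g25-1,
# design `HOME/b2b-balaban-gan24-p1/gen25/QR-DESIGN-v0.md` §3 «END (Q-R) ⟸ (REP) ∧ (LAY) ∧ (LT)»; RULING PREVIEW R-gan24p1-g26-1, journal l.40158 W4):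
# **THE END SOCKET OF THE WARD-LOCUS REMAINDER TOWER — the level-`n` remainder IN UNITS is bounded, UNIFORMLY IN `n`, by the sizes of the
# TRANSPORTED LAYER LETTERS** (row owner `b2b-balaban-gan24-p1`, gen 26)

NOT IN PRINT; OUR BOOKKEEPING ([folklore] assembly BY NAME: p2 g37's `WardResidualSUnits.unitS_duhamel_blockSum_comb` (the unrolled member of (REP) in units,
p318570 ✓) rewritten into the goal, then the owner's g25 `TowerBoundKFold.unrolled_bound` (the geometric sum under a subadditive size predicate, p317850 ✓);
0 cited facts, 0 `def`, 0 `def … : Prop`, 0 sorry).  HONEST FRAMING (cell contract, verbatim): «discharging `BetaPertH` makes Bałaban's UV stability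
UNCONDITIONAL — a real constructive-QFT result; it is NOT the continuum limit and NOT the Clay problem.»  HONEST DEPENDENCY (verbatim): «continuum YM on T⁴ ⇐
BetaPertH ∧ nine spine estimates (0/9 proved); BetaPertH ⇐ (D1) ∧ (D4) ∧ CAP+tail; G-an2-4 gates asym, D1 and NE2/3/4.»

WHAT.  (REP) (p2 PARTS 1–6; the unrolled identity `hunroll` below is PART 5 `WardResidualSUnrolled.exists_kernelLaws_unrolled`'s conclusion in table form at one
`(n, Y)`, taken as a HYPOTHESIS verbatim as in PART 6) says: the level-`n` Ward-locus remainder table `Φ n Y` is the level-0 letter's super-block partial sum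
transported `n` levels plus, for every `m < n`, the level-`m` sandwich letter's super-block partial sum `Σ_{w∈box Lc^{n−1−m}} σ m (Lc^{n−1−m}•Y + w)` transported
`n−1−m` levels by `𝔘 = unitStepMap Lc ρ (Lc^{d+1})` (leaf-01's unit S-step: ONE `push₃` through the dressed leg chain per composite,
`SrecBornSector.transport_unitStepMap_succ_eq_push₃`).  (LAY)∘(LT) (leaf-03 ∕ leaf-06 ∕ leaf-02 letters and supports ✓; leaf-01's (LT-1″) entry estimate, OPEN) are to
deliver, for each transported term, a size `C·θ^{n−1−m}` (`θ = Lc⁻¹` by the exponent ledger of R-gan24p1-g26-1: cubic count `+1`, shell `−1`, one local vanishing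
moment `−1`) in SOME subadditive size class `Good` — `LocStencil · · δ` at a fixed rate (§2), or its slot-weighted twin carrying the label-localisation of
QR-DESIGN §0 (§3).  THIS FILE is the END those rows feed: **`good_unitS_of_unrolled`** (§1, any subadditive monotone `Good` with `Good 0 0`):
`Good (unitS_n (Φ n Y)) (C₀ + C·(1 − θ)⁻¹)` — `C₀` the size of the transported level-0 term (ZERO for the literal of record: `Φ 0 ≡ 0` by an1's `RB ≡ RB″ ≡ 0` and
leaf-09's `RW ≡ RW″ ≡ 0`, p2 g37 W-R2 l.39922 — §4 `good_unitS_of_unrolled_zero`), UNIFORMLY IN `n` AND `Y`; §2 **`locStencil_unitS_of_unrolled`** (the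
`LocStencil` instance = the (H)-side currency up to the `j`-free scalar `Lc^{d+1}`, `WardResidualSUnits.unit_remainder_factor`); §3 **`wLocStencil_unitS_of_unrolled`**
(slot-WEIGHTED `LocStencil`: `∀ κ u, BiLoc (X κ u) u u (c·ω κ u) δ` for a fixed weight `ω ≥ 0` — the class in which the label-localisation `e^{−δ′·dist(u′, B(Y))}`
of QR-DESIGN §0 rides; subadditive ∕ monotone ∕ `0 0` proved here); §5 `table_eq_of_apply_eq` (PART 5's pointwise (UNROLLED) ⇒ the table-form `hunroll`).  Pure bookkeeping: the estimate (LT) and the letters' charge audit are the OPEN rows and enter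
ONLY as the displayed hypotheses `hΦ0 ∕ hσ`.

Discharges NOTHING of (Q-R) ∕ (LT) ∕ (Q-L) ∕ (C) ∕ «T2Shape» ∕ «T2Drift» ∕ (hW, hWall) by itself: (Q-R) follows from this END exactly when (LT∘LAY) supply `hσ` (and
`hΦ0`, trivial for the literal); NEVER «G-an2-4 closed» as (CONV-C); NOT D1, NOT `BetaPertH`, NOT continuum, NOT Clay.  2026-08-22.
-/

noncomputable section

open Finset
open scoped BigOperators
open Literature.MathematicalPhysics.QuantumFieldTheory
open Literature.MathematicalPhysics.QuantumFieldTheory.Balaban1983to89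
open Literature.MathematicalPhysics.QuantumFieldTheory.Balaban1983to89.Beta
open ExpKernelCalculus (MKer BiLoc)
open KernelWard (biLoc_add)
open AffineAveraging (Site box toSite)
open OneStepResolventKernel (Fib LocStencil)
open OneStepKernelFamily (KInvStep)
open BalabanStepJetsSucc (wE)
open StepJetData (locStencil_add)
open Summit.QuantumFields.BalabanUV.Beta.SpineRooted (e3OfK)
open Summit.QuantumFields.BalabanUV.Beta.AxialDressingRooted (coDressKBmAt)
open Summit.QuantumFields.BalabanUV.Beta.HessKerDressedUnits (unitS unitS_apply)
open Summit.QuantumFields.BalabanUV.Beta.GAN24.CombesThomas (sfStep smStep)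
open Summit.QuantumFields.BalabanUV.Beta.GAN24.ThirdJetKernel (e3K e3K_smul)
open Summit.QuantumFields.BalabanUV.Beta.GAN24.SrecBornSector (unitStepMap)
open Summit.QuantumFields.BalabanUV.Beta.GAN24.AffineUnroll (transport transport_zero transport_succ)
open Summit.QuantumFields.BalabanUV.Beta.GAN24.WardResidualSUnits (unitS_duhamel_blockSum_comb)
open Summit.QuantumFields.BalabanUV.Beta.GAN24.TowerBoundKFold (unrolled_bound)
open Summit.QuantumFields.BalabanUV.Beta.GAN24.StencilSlotOfShapes (locStencil_mono')
open Summit.QuantumFields.BalabanUV.Beta.GAN24.LocStencilTelescope (locStencil_zero)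

namespace Summit.QuantumFields.BalabanUV.Beta.GAN24.WardRemainderRows

variable {d Lc : ℕ} [NeZero Lc]

/-! ## §1 The END for an arbitrary subadditive size class -/

omit [NeZero Lc] in
/-- [folklore] **THE GEOMETRIC SUM IN A SUBADDITIVE SIZE CLASS, `range n` form** (the owner's `TowerBoundKFold.unrolled_bound` re-indexed to p2's
`m < n` with exponent `n − 1 − m`, plus the empty case `n = 0`): terms of sizes `C·θ^{n−1−m}` sum to a term of size `C·(1 − θ)⁻¹`, uniformly in `n`. -/
theorem good_sum_range_of_geometric {E : Type*} [AddCommMonoid E] (Good : E → ℝ → Prop) (h0 : Good 0 0)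
    (hadd : ∀ X X' c c', Good X c → Good X' c' → Good (X + X') (c + c')) (hmono : ∀ X c c', c ≤ c' → Good X c → Good X c')
    {θ C : ℝ} (hθ0 : 0 ≤ θ) (hθ1 : θ < 1) (hC : 0 ≤ C) (n : ℕ) (X : ℕ → E)
    (hX : ∀ m ∈ range n, Good (X m) (C * θ ^ (n - 1 - m))) :
    Good (∑ m ∈ range n, X m) (C * (1 - θ)⁻¹) := by
  cases n with
  | zero =>
      rw [Finset.sum_range_zero]
      have h1 : 0 ≤ C * (1 - θ)⁻¹ := mul_nonneg hC (inv_nonneg.2 (by linarith))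
      exact hmono 0 0 _ h1 h0
  | succ k =>
      refine unrolled_bound Good h0 hadd hmono hθ0 hθ1 hC k X fun m hm => ?_
      have e : k + 1 - 1 - m = k - m := by omega
      simpa [e] using hX m hm

/-- [folklore] **THE END «(Q-R) ⟸ (REP) ∧ (LT∘LAY)» IN AN ARBITRARY SUBADDITIVE SIZE CLASS.**  Let `Good` be a size predicate on label tables that holds at
`(0, 0)`, is subadditive and monotone in the constant.  If the tower `Φ` satisfies p2's unrolled identity at `(n, Y)` (hypothesis `hunroll`, VERBATIM the
hypothesis of `WardResidualSUnits.unitS_duhamel_blockSum_comb` = PART 5's conclusion in table form), the transported level-0 term has size `C₀`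
(`hΦ0`) and, for every `m < n`, the level-`m` sandwich letter's super-block partial sum transported `n − 1 − m` unit S-steps has size `C·θ^{n−1−m}`
(`hσ` — WHAT (LAY)∘(LT) DELIVER, `θ = Lc⁻¹`), then the level-`n` remainder IN UNITS has size `C₀ + C·(1 − θ)⁻¹` — a bound FREE OF `n` and `Y` as soon as
`C₀, C, θ` are.  (QR-DESIGN-v0 §3 (DUH) ∕ END.) -/
theorem good_unitS_of_unrolled
    (Good : (Fin (d + 1) → (Fin (d + 1) → ℤ) → MKer (d + 1) (Fib d)) → ℝ → Prop) (h0 : Good 0 0)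
    (hadd : ∀ X X' c c', Good X c → Good X' c' → Good (X + X') (c + c')) (hmono : ∀ X c c', c ≤ c' → Good X c → Good X c')
    {θ C₀ C : ℝ} (hθ0 : 0 ≤ θ) (hθ1 : θ < 1) (hC : 0 ≤ C) (ρ : Fin (d + 1) → ℤ)
    {Φ σ : ℕ → (Fin (d + 1) → ℤ) → Fin (d + 1) → (Fin (d + 1) → ℤ) → MKer (d + 1) (Fib d)} (n : ℕ) (Y : Fin (d + 1) → ℤ)
    (hunroll : Φ n Y =
      transport (fun j (S : Fin (d + 1) → (Fin (d + 1) → ℤ) → MKer (d + 1) (Fib d)) =>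
          fun κ' u' => ((Lc : ℝ) ^ (d + 1) * wE d Lc (j + 1)) • e3OfK Lc (coDressKBmAt ρ Lc (KInvStep (d := d) Lc j)) S κ' u') 0 n
          (∑ w ∈ box (d + 1) (Lc ^ n), Φ 0 (((Lc ^ n : ℕ) : ℤ) • Y + toSite w))
      + ∑ m ∈ Finset.range n,
          transport (fun j (S : Fin (d + 1) → (Fin (d + 1) → ℤ) → MKer (d + 1) (Fib d)) =>
              fun κ' u' => ((Lc : ℝ) ^ (d + 1) * wE d Lc (j + 1)) • e3OfK Lc (coDressKBmAt ρ Lc (KInvStep (d := d) Lc j)) S κ' u') (m + 1) (n - 1 - m)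
            (∑ w ∈ box (d + 1) (Lc ^ (n - 1 - m)), σ m (((Lc ^ (n - 1 - m) : ℕ) : ℤ) • Y + toSite w)))
    (hΦ0 : Good (transport (unitStepMap Lc ρ ((Lc : ℝ) ^ (d + 1))) 0 n
          (unitS (sfStep Lc 0) (smStep d Lc 0) (∑ w ∈ box (d + 1) (Lc ^ n), Φ 0 (((Lc ^ n : ℕ) : ℤ) • Y + toSite w)))) C₀)
    (hσ : ∀ m ∈ Finset.range n, Good (transport (unitStepMap Lc ρ ((Lc : ℝ) ^ (d + 1))) (m + 1) (n - 1 - m)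
          (unitS (sfStep Lc (m + 1)) (smStep d Lc (m + 1)) (∑ w ∈ box (d + 1) (Lc ^ (n - 1 - m)), σ m (((Lc ^ (n - 1 - m) : ℕ) : ℤ) • Y + toSite w))))
          (C * θ ^ (n - 1 - m))) :
    Good (unitS (sfStep Lc n) (smStep d Lc n) (Φ n Y)) (C₀ + C * (1 - θ)⁻¹) := by
  rw [unitS_duhamel_blockSum_comb ρ n Y hunroll]
  exact hadd _ _ _ _ hΦ0 (good_sum_range_of_geometric Good h0 hadd hmono hθ0 hθ1 hC n _ hσ)

/-! ## §2 The `LocStencil` instance: j-uniform bi-localisation at the slot -/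

omit [NeZero Lc] in
/-- [folklore] `LocStencil · · δ` at a fixed rate is a subadditive, monotone size class with `LocStencil 0 0 δ` (the tree's `locStencil_zero`, an3∕an1's
`locStencil_add`, the owner's `locStencil_mono'`, bundled in the shape §1 consumes). -/
theorem locStencil_good (δ : ℝ) :
    LocStencil (d := d) (0 : Fin (d + 1) → (Fin (d + 1) → ℤ) → MKer (d + 1) (Fib d)) 0 δ
    ∧ (∀ (X X' : Fin (d + 1) → (Fin (d + 1) → ℤ) → MKer (d + 1) (Fib d)) (c c' : ℝ),
        LocStencil X c δ → LocStencil X' c' δ → LocStencil (X + X') (c + c') δ)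
    ∧ (∀ (X : Fin (d + 1) → (Fin (d + 1) → ℤ) → MKer (d + 1) (Fib d)) (c c' : ℝ), c ≤ c' → LocStencil X c δ → LocStencil X c' δ) :=
  ⟨locStencil_zero le_rfl, fun _ _ _ _ h h' => fun κ u => locStencil_add h h' κ u, fun _ _ _ hcc' h => locStencil_mono' h hcc' le_rfl⟩

/-- [folklore] **THE END, `LocStencil` CURRENCY** ((Q-R)'s j-uniform bi-localisation at the slot, QR-DESIGN-v0 §0 first factor; the (H)-side currency up to
the `j`-free scalar `Lc^{d+1}` of `WardResidualSUnits.unit_remainder_factor`): under p2's unrolled identity at `(n, Y)`, if the transported level-0 term is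
`LocStencil … C₀ δ` and every transported sandwich letter is `LocStencil … (C·θ^{n−1−m}) δ` ((LAY)∘(LT)), then
`LocStencil (unitS_n (Φ n Y)) (C₀ + C·(1 − θ)⁻¹) δ`. -/
theorem locStencil_unitS_of_unrolled {δ θ C₀ C : ℝ} (hθ0 : 0 ≤ θ) (hθ1 : θ < 1) (hC : 0 ≤ C) (ρ : Fin (d + 1) → ℤ)
    {Φ σ : ℕ → (Fin (d + 1) → ℤ) → Fin (d + 1) → (Fin (d + 1) → ℤ) → MKer (d + 1) (Fib d)} (n : ℕ) (Y : Fin (d + 1) → ℤ)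
    (hunroll : Φ n Y =
      transport (fun j (S : Fin (d + 1) → (Fin (d + 1) → ℤ) → MKer (d + 1) (Fib d)) =>
          fun κ' u' => ((Lc : ℝ) ^ (d + 1) * wE d Lc (j + 1)) • e3OfK Lc (coDressKBmAt ρ Lc (KInvStep (d := d) Lc j)) S κ' u') 0 n
          (∑ w ∈ box (d + 1) (Lc ^ n), Φ 0 (((Lc ^ n : ℕ) : ℤ) • Y + toSite w))
      + ∑ m ∈ Finset.range n,
          transport (fun j (S : Fin (d + 1) → (Fin (d + 1) → ℤ) → MKer (d + 1) (Fib d)) =>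
              fun κ' u' => ((Lc : ℝ) ^ (d + 1) * wE d Lc (j + 1)) • e3OfK Lc (coDressKBmAt ρ Lc (KInvStep (d := d) Lc j)) S κ' u') (m + 1) (n - 1 - m)
            (∑ w ∈ box (d + 1) (Lc ^ (n - 1 - m)), σ m (((Lc ^ (n - 1 - m) : ℕ) : ℤ) • Y + toSite w)))
    (hΦ0 : LocStencil (transport (unitStepMap Lc ρ ((Lc : ℝ) ^ (d + 1))) 0 n
          (unitS (sfStep Lc 0) (smStep d Lc 0) (∑ w ∈ box (d + 1) (Lc ^ n), Φ 0 (((Lc ^ n : ℕ) : ℤ) • Y + toSite w)))) C₀ δ)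
    (hσ : ∀ m ∈ Finset.range n, LocStencil (transport (unitStepMap Lc ρ ((Lc : ℝ) ^ (d + 1))) (m + 1) (n - 1 - m)
          (unitS (sfStep Lc (m + 1)) (smStep d Lc (m + 1)) (∑ w ∈ box (d + 1) (Lc ^ (n - 1 - m)), σ m (((Lc ^ (n - 1 - m) : ℕ) : ℤ) • Y + toSite w))))
          (C * θ ^ (n - 1 - m)) δ) :
    LocStencil (unitS (sfStep Lc n) (smStep d Lc n) (Φ n Y)) (C₀ + C * (1 - θ)⁻¹) δ := by
  obtain ⟨h0, hadd, hmono⟩ := locStencil_good (d := d) δ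
  exact good_unitS_of_unrolled (fun X c => LocStencil X c δ) h0 hadd hmono hθ0 hθ1 hC ρ n Y hunroll hΦ0 hσ

/-! ## §3 The slot-weighted `LocStencil` instance: the class that carries the label-localisation -/

omit [NeZero Lc] in
/-- [folklore] **SLOT-WEIGHTED BI-LOCALISATION IS A SUBADDITIVE SIZE CLASS.**  For a fixed weight `ω ≥ 0` on the slots and a fixed rate `δ`, the predicate
`X ↦ ∀ κ u, BiLoc (X κ u) u u (c·ω κ u) δ` holds at `(0, 0)`, is subadditive and monotone in `c` — so §1 applies to it: this is the class in which the second
factor `e^{−δ′·dist₁(u′, Lc•B(Y))∕Lc}` of QR-DESIGN-v0 §0 (the LABEL-localisation (H) ∕ ι-WIN consume) rides through the END with `ω κ u :=` that factor. -/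
theorem wLocStencil_good (ω : Fin (d + 1) → (Fin (d + 1) → ℤ) → ℝ) (hω : ∀ κ u, 0 ≤ ω κ u) (δ : ℝ) :
    (∀ κ u, BiLoc ((0 : Fin (d + 1) → (Fin (d + 1) → ℤ) → MKer (d + 1) (Fib d)) κ u) u u (0 * ω κ u) δ)
    ∧ (∀ (X X' : Fin (d + 1) → (Fin (d + 1) → ℤ) → MKer (d + 1) (Fib d)) (c c' : ℝ),
        (∀ κ u, BiLoc (X κ u) u u (c * ω κ u) δ) → (∀ κ u, BiLoc (X' κ u) u u (c' * ω κ u) δ) →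
          ∀ κ u, BiLoc ((X + X') κ u) u u ((c + c') * ω κ u) δ)
    ∧ (∀ (X : Fin (d + 1) → (Fin (d + 1) → ℤ) → MKer (d + 1) (Fib d)) (c c' : ℝ), c ≤ c' →
        (∀ κ u, BiLoc (X κ u) u u (c * ω κ u) δ) → ∀ κ u, BiLoc (X κ u) u u (c' * ω κ u) δ) := by
  refine ⟨?_, ?_, ?_⟩
  · intro κ u x y a b
    simp
  · intro X X' c c' h h' κ u
    have := biLoc_add (h κ u) (h' κ u)
    rw [add_mul]
    exact this
  · intro X c c' hcc' h κ u x y a b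
    refine (h κ u x y a b).trans ?_
    exact mul_le_mul_of_nonneg_right (mul_le_mul_of_nonneg_right hcc' (hω κ u)) (Real.exp_pos _).le

/-- [folklore] **THE END, SLOT-WEIGHTED CURRENCY** (bi-localisation at the slot × a fixed slot weight `ω ≥ 0` — e.g. the label-localisation factor of
QR-DESIGN-v0 §0): under p2's unrolled identity at `(n, Y)`, if the transported level-0 term satisfies `∀ κ u, BiLoc (… κ u) u u (C₀·ω κ u) δ` and every
transported sandwich letter satisfies it with `C·θ^{n−1−m}·ω κ u`, then `∀ κ u, BiLoc (unitS_n (Φ n Y) κ u) u u ((C₀ + C·(1 − θ)⁻¹)·ω κ u) δ`. -/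
theorem wLocStencil_unitS_of_unrolled (ω : Fin (d + 1) → (Fin (d + 1) → ℤ) → ℝ) (hω : ∀ κ u, 0 ≤ ω κ u)
    {δ θ C₀ C : ℝ} (hθ0 : 0 ≤ θ) (hθ1 : θ < 1) (hC : 0 ≤ C) (ρ : Fin (d + 1) → ℤ)
    {Φ σ : ℕ → (Fin (d + 1) → ℤ) → Fin (d + 1) → (Fin (d + 1) → ℤ) → MKer (d + 1) (Fib d)} (n : ℕ) (Y : Fin (d + 1) → ℤ)
    (hunroll : Φ n Y =
      transport (fun j (S : Fin (d + 1) → (Fin (d + 1) → ℤ) → MKer (d + 1) (Fib d)) =>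
          fun κ' u' => ((Lc : ℝ) ^ (d + 1) * wE d Lc (j + 1)) • e3OfK Lc (coDressKBmAt ρ Lc (KInvStep (d := d) Lc j)) S κ' u') 0 n
          (∑ w ∈ box (d + 1) (Lc ^ n), Φ 0 (((Lc ^ n : ℕ) : ℤ) • Y + toSite w))
      + ∑ m ∈ Finset.range n,
          transport (fun j (S : Fin (d + 1) → (Fin (d + 1) → ℤ) → MKer (d + 1) (Fib d)) =>
              fun κ' u' => ((Lc : ℝ) ^ (d + 1) * wE d Lc (j + 1)) • e3OfK Lc (coDressKBmAt ρ Lc (KInvStep (d := d) Lc j)) S κ' u') (m + 1) (n - 1 - m)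
            (∑ w ∈ box (d + 1) (Lc ^ (n - 1 - m)), σ m (((Lc ^ (n - 1 - m) : ℕ) : ℤ) • Y + toSite w)))
    (hΦ0 : ∀ κ u, BiLoc (transport (unitStepMap Lc ρ ((Lc : ℝ) ^ (d + 1))) 0 n
          (unitS (sfStep Lc 0) (smStep d Lc 0) (∑ w ∈ box (d + 1) (Lc ^ n), Φ 0 (((Lc ^ n : ℕ) : ℤ) • Y + toSite w))) κ u) u u (C₀ * ω κ u) δ)
    (hσ : ∀ m ∈ Finset.range n, ∀ κ u, BiLoc (transport (unitStepMap Lc ρ ((Lc : ℝ) ^ (d + 1))) (m + 1) (n - 1 - m)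
          (unitS (sfStep Lc (m + 1)) (smStep d Lc (m + 1)) (∑ w ∈ box (d + 1) (Lc ^ (n - 1 - m)), σ m (((Lc ^ (n - 1 - m) : ℕ) : ℤ) • Y + toSite w))) κ u)
          u u (C * θ ^ (n - 1 - m) * ω κ u) δ) :
    ∀ κ u, BiLoc (unitS (sfStep Lc n) (smStep d Lc n) (Φ n Y) κ u) u u ((C₀ + C * (1 - θ)⁻¹) * ω κ u) δ := by
  obtain ⟨h0, hadd, hmono⟩ := wLocStencil_good (d := d) ω hω δ
  exact good_unitS_of_unrolled (fun X c => ∀ κ u, BiLoc (X κ u) u u (c * ω κ u) δ) h0 hadd hmono hθ0 hθ1 hC ρ n Y hunroll hΦ0 hσ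

/-! ## §4 The literal's case: the level-0 letter vanishes -/

omit [NeZero Lc] in
/-- [folklore] The unit rescaling of the zero table is zero. -/
theorem unitS_zero (sf sm : ℝ) :
    unitS sf sm (0 : Fin (d + 1) → (Fin (d + 1) → ℤ) → MKer (d + 1) (Fib d)) = 0 := by
  funext κ u x y a b
  simp [unitS_apply]

/-- [folklore] The unit S-step maps the zero table to zero (`e3K` is homogeneous: `ThirdJetKernel.e3K_smul` at `c = 0`). -/
theorem unitStepMap_zero (ρ : Fin (d + 1) → ℤ) (cE : ℝ) (j : ℕ) :
    unitStepMap Lc ρ cE j (0 : Fin (d + 1) → (Fin (d + 1) → ℤ) → MKer (d + 1) (Fib d)) = 0 := by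
  funext κ' u'
  have hz : (0 : Fin (d + 1) → (Fin (d + 1) → ℤ) → MKer (d + 1) (Fib d))
      = fun κ u => (0 : ℝ) • (0 : Fin (d + 1) → (Fin (d + 1) → ℤ) → MKer (d + 1) (Fib d)) κ u := by
    funext κ u; simp
  show (cE * (Lc : ℝ) ^ (2 * (d + 1))) • e3K (coDressKBmAt ρ Lc (CombesThomas.KStepUnit (d := d) Lc j)) Lc 0 κ' u' = (0 : MKer (d + 1) (Fib d))
  rw [hz, e3K_smul, zero_smul, smul_zero]

/-- [folklore] Hence every composite of unit S-steps maps the zero table to zero. -/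
theorem transport_unitStepMap_zero (ρ : Fin (d + 1) → ℤ) (cE : ℝ) (m k : ℕ) :
    transport (unitStepMap Lc ρ cE) m k (0 : Fin (d + 1) → (Fin (d + 1) → ℤ) → MKer (d + 1) (Fib d)) = 0 := by
  induction k with
  | zero => rfl
  | succ k ih => rw [transport_succ, ih, unitStepMap_zero]

/-- [folklore] **THE END FOR THE LITERAL OF RECORD** (`Φ 0 ≡ 0`: an1 g57 `RB ≡ RB″ ≡ 0`, leaf-09 `RW ≡ RW″ ≡ 0`, p2 g37 W-R2 — EVERY transported object is a
sandwich letter): in any subadditive monotone size class with `Good 0 0`, the sizes `C·θ^{n−1−m}` of the transported sandwich letters ALONE give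
`Good (unitS_n (Φ n Y)) (C·(1 − θ)⁻¹)`, uniformly in `n`, `Y`. -/
theorem good_unitS_of_unrolled_zero
    (Good : (Fin (d + 1) → (Fin (d + 1) → ℤ) → MKer (d + 1) (Fib d)) → ℝ → Prop) (h0 : Good 0 0)
    (hadd : ∀ X X' c c', Good X c → Good X' c' → Good (X + X') (c + c')) (hmono : ∀ X c c', c ≤ c' → Good X c → Good X c')
    {θ C : ℝ} (hθ0 : 0 ≤ θ) (hθ1 : θ < 1) (hC : 0 ≤ C) (ρ : Fin (d + 1) → ℤ)
    {Φ σ : ℕ → (Fin (d + 1) → ℤ) → Fin (d + 1) → (Fin (d + 1) → ℤ) → MKer (d + 1) (Fib d)} (hΦ00 : ∀ y, Φ 0 y = 0) (n : ℕ) (Y : Fin (d + 1) → ℤ)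
    (hunroll : Φ n Y =
      transport (fun j (S : Fin (d + 1) → (Fin (d + 1) → ℤ) → MKer (d + 1) (Fib d)) =>
          fun κ' u' => ((Lc : ℝ) ^ (d + 1) * wE d Lc (j + 1)) • e3OfK Lc (coDressKBmAt ρ Lc (KInvStep (d := d) Lc j)) S κ' u') 0 n
          (∑ w ∈ box (d + 1) (Lc ^ n), Φ 0 (((Lc ^ n : ℕ) : ℤ) • Y + toSite w))
      + ∑ m ∈ Finset.range n,
          transport (fun j (S : Fin (d + 1) → (Fin (d + 1) → ℤ) → MKer (d + 1) (Fib d)) =>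
              fun κ' u' => ((Lc : ℝ) ^ (d + 1) * wE d Lc (j + 1)) • e3OfK Lc (coDressKBmAt ρ Lc (KInvStep (d := d) Lc j)) S κ' u') (m + 1) (n - 1 - m)
            (∑ w ∈ box (d + 1) (Lc ^ (n - 1 - m)), σ m (((Lc ^ (n - 1 - m) : ℕ) : ℤ) • Y + toSite w)))
    (hσ : ∀ m ∈ Finset.range n, Good (transport (unitStepMap Lc ρ ((Lc : ℝ) ^ (d + 1))) (m + 1) (n - 1 - m)
          (unitS (sfStep Lc (m + 1)) (smStep d Lc (m + 1)) (∑ w ∈ box (d + 1) (Lc ^ (n - 1 - m)), σ m (((Lc ^ (n - 1 - m) : ℕ) : ℤ) • Y + toSite w))))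
          (C * θ ^ (n - 1 - m))) :
    Good (unitS (sfStep Lc n) (smStep d Lc n) (Φ n Y)) (C * (1 - θ)⁻¹) := by
  have hsum0 : (∑ w ∈ box (d + 1) (Lc ^ n), Φ 0 (((Lc ^ n : ℕ) : ℤ) • Y + toSite w)) = 0 :=
    Finset.sum_eq_zero fun w _ => hΦ00 _
  have hΦ0 : Good (transport (unitStepMap Lc ρ ((Lc : ℝ) ^ (d + 1))) 0 n
      (unitS (sfStep Lc 0) (smStep d Lc 0) (∑ w ∈ box (d + 1) (Lc ^ n), Φ 0 (((Lc ^ n : ℕ) : ℤ) • Y + toSite w)))) 0 := by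
    rw [hsum0, unitS_zero, transport_unitStepMap_zero]
    exact h0
  have h := good_unitS_of_unrolled Good h0 hadd hmono hθ0 hθ1 hC ρ n Y hunroll hΦ0 hσ
  simpa using h

/-! ## §5 The junction with PART 5's pointwise form -/

omit [NeZero Lc] in
/-- [folklore] **POINTWISE ⇒ TABLE FORM.**  p2's PART 5 `WardResidualSUnrolled.exists_kernelLaws_unrolled` states (UNROLLED) pointwise in the slot `(κ′, u′)` with
the `m`-sum outside the application; the hypothesis `hunroll` of §1–§4 (= PART 6's) is the same identity at TABLE level.  The bridge: `funext` and
`Finset.sum_apply` twice — so an assembler writes `hunroll := table_eq_of_apply_eq (hU n Y)` with `hU` the (UNROLLED) conjunct. -/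
theorem table_eq_of_apply_eq {Φ A : Fin (d + 1) → (Fin (d + 1) → ℤ) → MKer (d + 1) (Fib d)}
    {B : ℕ → Fin (d + 1) → (Fin (d + 1) → ℤ) → MKer (d + 1) (Fib d)} {s : Finset ℕ}
    (h : ∀ κ' u', Φ κ' u' = A κ' u' + ∑ m ∈ s, B m κ' u') : Φ = A + ∑ m ∈ s, B m := by
  funext κ' u'
  simp only [h κ' u', Pi.add_apply, Finset.sum_apply]

end Summit.QuantumFields.BalabanUV.Beta.GAN24.WardRemainderRows

end
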